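import Summits.QuantumFields.BalabanUV.T4Continuum.Support.DirichletFreeTower

/-!
# T⁴ programme, spine node NE2 (U1a), sub-row Δ1 «NE2⁰-Dirichlet» — THE FIRST TIER RE-RUN OVER THE REGION: zeroth-order (potential-type)
# perturbations `P_k = diag(W^{(k)})` satisfy `PerturbationLaws` against the Ω-RESTRICTED free tower with the torus constants (×`(d+1)`), hence the
# Ω-restricted perturbed covariances converge MODULO the injected law `hinj` — `towerLimitRate_dirichlet_perturbed` made concrete

Eleventh generation of the NE2 prover lineage P1 of the cell `pub-balaban` (row NE2 owner), file 9 (addendum to `Support/DirichletFreeTower` p219101,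
whose §4 says «the whole resolvent route of tiers A/B runs VERBATIM over the restricted carriers for any compressed perturbation family obeying
`PerturbationLaws`»).  This file discharges that for the simplest class — the gen-9 ZEROTH-ORDER family of `Support/PerturbationAlgebra`
(`BoundedBackground W α β`: a bounded potential sampled at every spacing with two-spacing consistency at the block parent):

 * §1 `diagR S₀ W k := (diag W^{(k)})_{ΩΩ}`; **`perturbationLaws_zerothOrder_dirichlet`**: `BoundedBackground W α β ⟹
   PerturbationLaws (DalevR S₀) (diagR S₀ W) (JpcTR S₀) (α·(d+1)Cst) ((d+1)Cst·β·(d+1)Cst·L^{−k})` — (H-bd) from `‖G(Ω)‖ ≤ (d+1)Cst`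
   (`DirichletRegionTower.opNorm_inv_DalevR_le`), (H-cons) from the torus identity `diag W′·J − J·diag W = (diag W′ − diag(W∘parT))·J`
   (`BlockPairingGeometry.JK_mul_diagonal`) compressed (diagonals and King's pairing are region-compatible);
 * §2 **`towerLimitRate_dirichlet_zerothOrder_of_injected`**: with the injected law `hinj` (majorant `C₁θ^k`, `L⁻¹ ≤ θ < 1`) and `‖t‖·α(d+1)Cst < 1`,
   the Ω-restricted unit-lattice covariances of `(Δ_a^{(k)})_{ΩΩ} + t·diag(W^{(k)})_{ΩΩ}` CONVERGE at rate `θ` (`DirichletFreeTower.towerLimitRate_dirichlet_perturbed`).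

HONEST FRAMING (T4-DAG p. 1).  `U = 1` free tower + an abelian potential (model level); ONE region; finite torus; linear layer; operator norm;
[folklore] over landed modules; CONDITIONAL on the displayed `hinj` (the typed wall of Δ1); NE2 (U1a) NOT proved; spine 0/9 unchanged; NOT
infinite volume, NOT a mass gap, NOT the Clay problem, NOT summit progress.  HONEST DEPENDENCY: continuum YM on T⁴ ⇐ BetaPertH ∧ nine spine estimates
(0/9 proved); BetaPertH ⇐ (D1) ∧ (D4) ∧ CAP+tail; G-an2-4 gates asym, D1 and NE2/3/4.  No `sorry`.
-/

noncomputable section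

open scoped BigOperators ComplexConjugate Matrix Matrix.Norms.L2Operator

namespace Summit.QuantumFields.BalabanUV.T4Continuum.DirichletZerothOrder

open Literature.MathematicalPhysics.QuantumFieldTheory.Balaban1983to89.B5Prop11Plancherel (Cst Cst_nonneg Tor fine)
open Literature.MathematicalPhysics.QuantumFieldTheory.Balaban1983to89.B5G183RateUnitTower (lev lev_neZero)
open Summit.QuantumFields.BalabanUV.T4Continuum
open Summit.QuantumFields.BalabanUV.T4Continuum.CovariantAveragingTower (TowerLimitRate)
open Summit.QuantumFields.BalabanUV.T4Continuum.BalabanAveragedTowerUnit (idx Qlev one_le_lev' cast_lev')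
open Summit.QuantumFields.BalabanUV.T4Continuum.BackgroundResolventTower
open Summit.QuantumFields.BalabanUV.T4Continuum.KingPairingPlantedLaw (JpcT JpcT_eq_JK opNorm_JpcT_le calDalev)
open Summit.QuantumFields.BalabanUV.T4Continuum.BlockPairingGeometry (opNorm_diagonal_le parT JK_mul_diagonal)
open Summit.QuantumFields.BalabanUV.T4Continuum.PerturbationAlgebra (BoundedBackground perturbationLaws_mono)
open Summit.QuantumFields.BalabanUV.T4Continuum.SubtypeCompression
open Summit.QuantumFields.BalabanUV.T4Continuum.DirichletRegionTower
open Summit.QuantumFields.BalabanUV.T4Continuum.DirichletFreeTower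

variable {d : ℕ} (L : ℕ) [NeZero L] (M : Fin d → ℕ) [hM : ∀ μ, NeZero (M μ)] (a : ℝ) (ha : 0 < a)
variable (S₀ : idx L M 0 → Prop) [DecidablePred S₀]

/-! ## §1 Zeroth-order perturbations compressed to the region obey `PerturbationLaws` -/

/-- the potential `diag(W^{(k)})` restricted to the region. [folklore] -/
def diagR (W : (k : ℕ) → (idx L M k → ℂ)) (k : ℕ) : Matrix (ridx L M S₀ k) (ridx L M S₀ k) ℂ :=
  (Matrix.diagonal (W k)).toBlock (inReg L M S₀ k) (inReg L M S₀ k)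

omit [NeZero L] hM [DecidablePred S₀] in
/-- a diagonal never couples the region to its complement (either way). [folklore] -/
theorem diagonal_vanish {k : ℕ} (V : idx L M k → ℂ) : ∀ (i j : idx L M k), inReg L M S₀ k i → ¬ inReg L M S₀ k j → Matrix.diagonal V i j = 0 := by
  intro i j hi hj
  have hne : i ≠ j := fun h => hj (h ▸ hi)
  rw [Matrix.diagonal_apply_ne _ hne]

omit [NeZero L] hM [DecidablePred S₀] in
/-- … (the other way). [folklore] -/
theorem diagonal_vanish' {k : ℕ} (V : idx L M k → ℂ) : ∀ (i j : idx L M k), ¬ inReg L M S₀ k i → inReg L M S₀ k j → Matrix.diagonal V i j = 0 := by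
  intro i j hi hj
  have hne : i ≠ j := fun h => hi (h ▸ hj)
  rw [Matrix.diagonal_apply_ne _ hne]

/-- **`PerturbationLaws` AT ZEROTH ORDER OVER THE REGION**: `BoundedBackground W α β ⟹ PerturbationLaws (DalevR S₀) (diagR S₀ W) (JpcTR S₀) (α(d+1)Cst)
((d+1)Cst·β·(d+1)Cst·L^{−k})` — the torus proof of `PerturbationAlgebra.perturbationLaws_zerothOrder` with `‖G(Ω)‖ ≤ (d+1)Cst` in place of `‖𝒢‖ ≤ Cst`.
[folklore] -/
theorem perturbationLaws_zerothOrder_dirichlet {W : (k : ℕ) → (idx L M k → ℂ)} {α β : ℝ} (hW : BoundedBackground L M W α β) :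
    PerturbationLaws (DalevR L M a ha S₀) (diagR L M S₀ W) (JpcTR L M S₀) (α * (((d : ℝ) + 1) * Cst d a))
      (fun k => (((d : ℝ) + 1) * Cst d a) * β * (((d : ℝ) + 1) * Cst d a) * ((L : ℝ)⁻¹) ^ k) where
  opNorm_P_mul_inv_le := fun k =>
    (Matrix.l2_opNorm_mul _ _).trans (mul_le_mul ((opNorm_toBlock_le _ _ _).trans (opNorm_diagonal_le _ hW.nonneg.1 (hW.bound k)))
      (opNorm_inv_DalevR_le L M a ha S₀ k) (norm_nonneg _) hW.nonneg.1)
  opNorm_inv_mul_P_le := fun k => by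
    rw [mul_comm α]
    exact (Matrix.l2_opNorm_mul _ _).trans (mul_le_mul (opNorm_inv_DalevR_le L M a ha S₀ k)
      ((opNorm_toBlock_le _ _ _).trans (opNorm_diagonal_le _ hW.nonneg.1 (hW.bound k))) (norm_nonneg _) (K_pos (d := d) a).le)
  consistent_le := fun k => by
    have hlev : (0 : ℝ) < (lev L k : ℕ) := by exact_mod_cast one_le_lev' L k
    have hK : 0 ≤ ((d : ℝ) + 1) * Cst d a := (K_pos (d := d) a).le
    set p' := inReg L M S₀ (k + 1)
    set p := inReg L M S₀ k
    -- the compressed commutator is the compressed torus commutator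
    set Dg : Matrix (idx L M (k + 1)) (idx L M (k + 1)) ℂ :=
      Matrix.diagonal (W (k + 1)) - Matrix.diagonal (fun i : idx L M (k + 1) => W k (parT (lev L k) L M i)) with hDg
    have e : diagR L M S₀ W (k + 1) * JpcTR L M S₀ k - JpcTR L M S₀ k * diagR L M S₀ W k = Dg.toBlock p' p' * JpcTR L M S₀ k := by
      have h1 : diagR L M S₀ W (k + 1) * JpcTR L M S₀ k = (Matrix.diagonal (W (k + 1)) * JpcT L M k).toBlock p' p :=
        (toBlock_mul_of_vanish_left _ _ _ _ _ (diagonal_vanish L M S₀ (W (k + 1)))).symm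
      have h2 : JpcTR L M S₀ k * diagR L M S₀ W k = (JpcT L M k * Matrix.diagonal (W k)).toBlock p' p :=
        (toBlock_mul_of_vanish_right _ _ _ _ _ (diagonal_vanish' L M S₀ (W k))).symm
      have h3 : JpcT L M k * Matrix.diagonal (W k) = Matrix.diagonal (fun i : idx L M (k + 1) => W k (parT (lev L k) L M i)) * JpcT L M k :=
        JK_mul_diagonal (lev L k) L M (W k)
      have h4 : Dg.toBlock p' p' * JpcTR L M S₀ k = (Dg * JpcT L M k).toBlock p' p := by
        rw [JpcTR, hDg]
        refine (toBlock_mul_of_vanish_left _ _ _ _ _ fun i j hi hj => ?_).symm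
        have hne : i ≠ j := fun h => hj (h ▸ hi)
        rw [Matrix.sub_apply, Matrix.diagonal_apply_ne _ hne, Matrix.diagonal_apply_ne _ hne, sub_zero]
      rw [h1, h2, h3, h4, ← toBlock_sub, hDg, Matrix.sub_mul]
    have hdiff : ‖Dg.toBlock p' p'‖ ≤ β / (lev L k : ℕ) := by
      refine (opNorm_toBlock_le _ _ _).trans ?_
      rw [hDg, Matrix.diagonal_sub]
      exact opNorm_diagonal_le _ (div_nonneg hW.nonneg.2 hlev.le) fun i => hW.consistent k i
    rw [e, ← Matrix.mul_assoc]
    calc _ ≤ ‖(DalevR L M a ha S₀ (k + 1))⁻¹ * Dg.toBlock p' p' * JpcTR L M S₀ k‖ * ‖(DalevR L M a ha S₀ k)⁻¹‖ := Matrix.l2_opNorm_mul _ _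
      _ ≤ ‖(DalevR L M a ha S₀ (k + 1))⁻¹ * Dg.toBlock p' p'‖ * ‖JpcTR L M S₀ k‖ * ‖(DalevR L M a ha S₀ k)⁻¹‖ :=
          mul_le_mul_of_nonneg_right (Matrix.l2_opNorm_mul _ _) (norm_nonneg _)
      _ ≤ ((((d : ℝ) + 1) * Cst d a) * (β / (lev L k : ℕ))) * 1 * (((d : ℝ) + 1) * Cst d a) := by
          have h0 : 0 ≤ (((d : ℝ) + 1) * Cst d a) * (β / (lev L k : ℕ)) := mul_nonneg hK (div_nonneg hW.nonneg.2 hlev.le)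
          refine mul_le_mul (mul_le_mul ((Matrix.l2_opNorm_mul _ _).trans (mul_le_mul (opNorm_inv_DalevR_le L M a ha S₀ (k + 1))
            hdiff (norm_nonneg _) hK)) (opNorm_JpcTR_le L M S₀ k) (norm_nonneg _) h0) (opNorm_inv_DalevR_le L M a ha S₀ k)
            (norm_nonneg _) (mul_nonneg h0 zero_le_one)
      _ = (((d : ℝ) + 1) * Cst d a) * β * (((d : ℝ) + 1) * Cst d a) * ((L : ℝ)⁻¹) ^ k := by rw [cast_lev', inv_pow]; ring

/-! ## §2 The Ω-restricted perturbed covariances converge modulo the injected law -/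

/-- **THE ZEROTH-ORDER TIER OVER THE REGION, MODULO `hinj`** (`L⁻¹ ≤ θ < 1`): for a bounded two-spacing-consistent potential `W`, the injected law of
the Dirichlet tower with majorant `C₁θ^k`, and a coupling `‖t‖·α(d+1)Cst < 1`, the Ω-restricted unit-lattice covariances of
`(Δ_a^{(k)})_{ΩΩ} + t·diag(W^{(k)})_{ΩΩ}` converge at rate `θ` with the displayed constant. [folklore] -/
theorem towerLimitRate_dirichlet_zerothOrder_of_injected {θ C₁ : ℝ} (hθ : ((L : ℝ)⁻¹) ≤ θ) (hθ1 : θ < 1)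
    (hinj : ∀ k, ‖(DalevR L M a ha S₀ (k + 1))⁻¹ * JpcTR L M S₀ k - JpcTR L M S₀ k * (DalevR L M a ha S₀ k)⁻¹‖ ≤ C₁ * θ ^ k)
    {W : (k : ℕ) → (idx L M k → ℂ)} {α β : ℝ} (hW : BoundedBackground L M W α β) {t : ℂ}
    (ht : ‖t‖ * (α * (((d : ℝ) + 1) * Cst d a)) < 1) :
    TowerLimitRate (QlevR L M S₀) ((L : ℝ) ^ d) (fun k => (DalevR L M a ha S₀ k + t • diagR L M S₀ W k)⁻¹)
      (Cpert (α * (((d : ℝ) + 1) * Cst d a)) (2 * d * (((d : ℝ) + 1) * Cst d a)) C₁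
        ((((d : ℝ) + 1) * Cst d a) * β * (((d : ℝ) + 1) * Cst d a)) 0 t) θ := by
  have hK : 0 ≤ ((d : ℝ) + 1) * Cst d a := (K_pos (d := d) a).le
  have hC₂ : 0 ≤ (((d : ℝ) + 1) * Cst d a) * β * (((d : ℝ) + 1) * Cst d a) := mul_nonneg (mul_nonneg hK hW.nonneg.2) hK
  have hpert := perturbationLaws_mono (perturbationLaws_zerothOrder_dirichlet L M a ha S₀ hW) le_rfl
    (fun k => mul_le_mul_of_nonneg_left (pow_le_pow_left₀ (inv_nonneg.mpr (Nat.cast_nonneg L)) hθ k) hC₂)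
  exact towerLimitRate_dirichlet_perturbed L M a ha S₀ hθ hθ1 hinj hpert ht

end Summit.QuantumFields.BalabanUV.T4Continuum.DirichletZerothOrder

end
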